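import Literature.MathematicalPhysics.QuantumFieldTheory.WilsonPartitionRegularVariation
import Literature.MathematicalPhysics.QuantumFieldTheory.WilsonEnergyConvexity
import Literature.Analysis.Asymptotics.LaplacePowerLogAbelian
import HarnessLib

/-!
# Regular variation of the Wilson partition function: the proved layers

Sibling of `WilsonPartitionRegularVariation.lean` (named fact
`Literature.MathematicalPhysics.QuantumFieldTheory.WilsonPartitionRegularVariation`:
`Z_L(β) β^λ/(log β)^m → C > 0` as `β → ∞` for the fixed-torus Wilson partition function of a
compact group with a faithful unitary lattice representation). Everything here is PROVED; there
are no definitions and no named facts. The file does NOT discharge the fact; it lands the layers of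
the printed proof (Arnold–Gusein-Zade–Varchenko II, §7.3: resolution of singularities ⟹ power-log
asymptotics of the sublevel volume `V(t) = vol{S < t}` (Corollary of Thm. 7.6) ⟺ power-log
asymptotics of the Laplace integral (Thm. 7.6)) that come first (the discharge happens downstream,
see the last paragraph of this docstring):

* `wilsonPartitionRegularVariation_of_sublevelVolume` — **the Abelian layer**: if for every
  `(G, r, L)` the product-Haar volume of the sublevel sets of the Wilson action satisfies
  `Haar^{⊗E}{S ≤ t} ∼ c t^λ (log 1/t)^m` as `t → 0⁺` (`c > 0`, `λ ≥ 0`, `m ∈ ℕ` — this is the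
  Corollary of AGV II Thm. 7.6 / Watanabe 2009 Thm. 7.1 (4) for the Wilson phase, i.e. exactly the
  resolution-of-singularities content), then
  `WilsonPartitionRegularVariation` holds, with `C = c Γ(λ+1)`
  (`Literature.Analysis.Asymptotics.LaplacePowerLog.tendsto_laplace_mul_rpow_div_log_pow`).
* `tendsto_partitionFunction_of_finite` — **the finite-group case, outright**: for finite `G`
  the sublevel volume is eventually constant, `Z_L(β) → Haar^{⊗E}{S = 0} > 0`, i.e. the
  conclusion of the fact with `λ = 0`, `m = 0`.

The geometric layer — for infinite `G` (a compact Lie group of positive dimension, `ρ(G) ⊆ U(N)`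
closed), the power-log asymptotics at the zeros of the phase, whose every printed proof rests on an
embedded resolution of singularities of the real-analytic phase `S` on the compact real-analytic
manifold `ρ(G)^E` (AGV II §6.4, §7.3; Watanabe 2009 Thm. 2.3, 6.1; Lin, arXiv:1003.5338, Thm. 2.2,
2.9) — is NOT in this file but is PROVED downstream of it, in this directory:
`WilsonPartitionLaplaceForm` (tube reduction to Laplace integrals over compact semianalytic sets)
→ `WilsonPartitionResolutionForm` / `WilsonPartitionHironakaForm` (monomial pieces from resolution
data) → `WilsonPartitionLocalResolution` (pointwise resolution data suffice) →
`WilsonPartitionTubeForm` (product form of the tube: polynomial phase in the group coordinate) →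
`WilsonPartitionRegularVariationHolds`, whose theorem
`WilsonPartitionRegularVariation_holds : WilsonPartitionRegularVariation` discharges the fact, the
resolution being Kollár's log resolution
(`Literature.AlgebraicGeometry.Resolution.exists_logResolution_of_isClosed`) applied to the regular
Wilson action on a smooth real algebraic local model of the compact linear group `ρ(G)^E`
(Chevalley), read at real points (`Literature/AlgebraicGeometry/RealAlgebraic/RealPoints*`).

## References

* V. I. Arnold, S. M. Gusein-Zade, A. N. Varchenko, *Singularities of Differentiable Maps II*,
  Birkhäuser (2012), Part II §7.3 Thm. 7.6 and Corollary. [ArnoldGuseinzadeVarchenko2012]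
* S. Watanabe, *Algebraic Geometry and Statistical Learning Theory* (2009), Thm. 7.1.
  [WatanabeSumio2009]
-/

noncomputable section

open MeasureTheory Filter Set Topology
open Literature.Analysis.Asymptotics

namespace Literature.MathematicalPhysics.QuantumFieldTheory

section General

variable {G : Type} [Group G] [TopologicalSpace G] [IsTopologicalGroup G] [CompactSpace G]
  [MeasurableSpace G] [BorelSpace G]

omit [IsTopologicalGroup G] [CompactSpace G] [MeasurableSpace G] [BorelSpace G] in
/-- `Re tr ρ(g) ≤ N` for a unitary lattice representation. [folklore] -/
theorem LatticeRep.re_trace_le (r : LatticeRep G) (g : G) : (r.ρ g).trace.re ≤ r.N := by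
  rw [Matrix.trace, Complex.re_sum]
  calc ∑ i, ((r.ρ g).diag i).re ≤ ∑ _i : Fin r.N, (1 : ℝ) :=
        Finset.sum_le_sum fun i _ => (Complex.re_le_norm _).trans
          (entry_norm_bound_of_unitary (r.mem_unitary g) i i)
    _ = r.N := by simp

omit [IsTopologicalGroup G] [CompactSpace G] [MeasurableSpace G] [BorelSpace G] in
/-- The Wilson action of a unitary lattice representation is non-negative. [folklore] -/
theorem LatticeRep.wilsonAction_nonneg (r : LatticeRep G) {d L : ℕ} [NeZero L]
    (U : GaugeConfig d L G) : 0 ≤ wilsonAction r.ρ U :=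
  wilsonAction_nonneg_of_re_trace_le r.ρ r.re_trace_le U

/-- **The Abelian layer of `WilsonPartitionRegularVariation`.** If for every compact `G` with a
faithful unitary lattice representation `r` and every torus side `L ≥ 1` the product-Haar volume of
the sublevel sets of the Wilson action is regularly varying at `0⁺` in the power-log scale,
`Haar^{⊗E}{S ≤ t} / (t^λ (log t⁻¹)^m) → c` with `c > 0`, `λ ≥ 0` (the Corollary of AGV II
Thm. 7.6 for the Wilson phase — the resolution-of-singularities content), then
`Z_L(β) β^λ/(log β)^m → c Γ(λ+1) > 0`, i.e. the named fact holds. (AGV II §7.3.3: Thm. 7.6 from its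
Corollary by the Laplace transform of `t^α (ln t)^k`.)
[cite: ArnoldGuseinzadeVarchenko2012, Part II §7.3.3 Thm. 7.6 and Corollary; §7.2.4 formula after Thm. 7.4] -/
theorem wilsonPartitionRegularVariation_of_sublevelVolume
    (h : ∀ (G : Type) [Group G] [TopologicalSpace G] [IsTopologicalGroup G] [CompactSpace G]
      [MeasurableSpace G] [BorelSpace G] (r : LatticeRep G) (L : ℕ) [NeZero L],
      ∃ (c lam : ℝ) (m : ℕ), 0 < c ∧ 0 ≤ lam ∧
        Tendsto (fun t : ℝ =>
          ((Measure.pi fun _ : Edge 4 L => haarProbability G)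
              {U | wilsonAction r.ρ U ≤ t}).toReal / (t ^ lam * Real.log t⁻¹ ^ m))
          (𝓝[>] 0) (𝓝 c)) :
    WilsonPartitionRegularVariation := by
  intro G _ _ _ _ _ _ r L _
  obtain ⟨c, lam, m, hc, hlam, hV⟩ := h G r L
  refine ⟨c * Real.Gamma (lam + 1), lam, m, mul_pos hc (Real.Gamma_pos_of_pos (by linarith)),
    hlam, ?_⟩
  have key := LaplacePowerLog.tendsto_laplace_mul_rpow_div_log_pow
    (μ := Measure.pi fun _ : Edge 4 L => haarProbability G)
    (WilsonRP.measurable_wilsonAction r.ρ r.continuous) r.wilsonAction_nonneg hlam hV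
  refine key.congr' (Eventually.of_forall fun β => ?_)
  simp only [partitionFunction_toReal_eq_integral r.ρ r.continuous β, neg_mul]

end General

/-! ### Finite gauge groups -/

section FiniteGroup

variable {G : Type} [Group G] [TopologicalSpace G] [IsTopologicalGroup G] [CompactSpace G]
  [MeasurableSpace G] [BorelSpace G]

omit [IsTopologicalGroup G] [CompactSpace G] [MeasurableSpace G] [BorelSpace G] in
/-- A group with a faithful continuous matrix representation is `T₁` (indeed Hausdorff).
[folklore] -/
theorem LatticeRep.t1Space (r : LatticeRep G) : T1Space G := by
  refine ⟨fun g => ?_⟩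
  have : ({g} : Set G) = r.ρ ⁻¹' {r.ρ g} := by
    ext x
    simp only [mem_singleton_iff, mem_preimage]
    exact ⟨fun h => by rw [h], fun h => r.injective h⟩
  rw [this]
  exact isClosed_singleton.preimage r.continuous

omit [IsTopologicalGroup G] [CompactSpace G] [MeasurableSpace G] [BorelSpace G] in
/-- For a finite gauge group the sublevel volume of the Wilson action is eventually constant at
`0⁺`: there is `t₀ > 0` with `Haar^{⊗E}{S ≤ t} = Haar^{⊗E}{S ≤ 0}` for `0 ≤ t < t₀` (the action
takes finitely many values). [folklore] -/
theorem exists_sublevel_eq_of_finite [Finite G] (r : LatticeRep G) (L : ℕ) [NeZero L] :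
    ∃ t₀ : ℝ, 0 < t₀ ∧ ∀ t : ℝ, 0 ≤ t → t < t₀ →
      {U : GaugeConfig 4 L G | wilsonAction r.ρ U ≤ t} = {U | wilsonAction r.ρ U ≤ 0} := by
  classical
  haveI : Fintype G := Fintype.ofFinite G
  -- the positive values of the action
  set P : Finset ℝ := (Finset.univ.image fun U : GaugeConfig 4 L G => wilsonAction r.ρ U).filter
    fun s => 0 < s with hP
  have hmemP : ∀ U : GaugeConfig 4 L G, 0 < wilsonAction r.ρ U → wilsonAction r.ρ U ∈ P :=
    fun U hU => Finset.mem_filter.2 ⟨Finset.mem_image_of_mem _ (Finset.mem_univ U), hU⟩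
  by_cases hPe : P.Nonempty
  · refine ⟨P.min' hPe, (Finset.mem_filter.1 (Finset.min'_mem P hPe)).2, fun t ht0 ht => ?_⟩
    ext U
    simp only [mem_setOf_eq]
    refine ⟨fun hU => ?_, fun hU => hU.trans ht0⟩
    rcases le_or_gt (wilsonAction r.ρ U) 0 with hle | hpos
    · exact hle
    · exact absurd (Finset.min'_le P _ (hmemP U hpos)) (not_le.2 (hU.trans_lt ht))
  · refine ⟨1, one_pos, fun t ht0 _ => ?_⟩
    ext U
    simp only [mem_setOf_eq]
    refine ⟨fun _ => ?_, fun hU => hU.trans ht0⟩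
    rcases le_or_gt (wilsonAction r.ρ U) 0 with hle | hpos
    · exact hle
    · exact absurd ⟨_, hmemP U hpos⟩ hPe

/-- For a finite gauge group the zero set of the Wilson action has positive product-Haar measure
(it contains the trivial configuration, an atom of the product of normalised counting measures).
[folklore] -/
theorem measure_wilsonAction_le_zero_pos [Finite G] (r : LatticeRep G) (L : ℕ) [NeZero L] :
    0 < (Measure.pi fun _ : Edge 4 L => haarProbability G) {U | wilsonAction r.ρ U ≤ 0} := by
  haveI : T1Space G := r.t1Space
  have h1 : (1 : GaugeConfig 4 L G) ∈ {U : GaugeConfig 4 L G | wilsonAction r.ρ U ≤ 0} := by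
    simp only [mem_setOf_eq, wilsonAction_one_eq_zero, le_refl]
  refine lt_of_lt_of_le ?_ (measure_mono (singleton_subset_iff.2 h1))
  rw [← univ_pi_singleton (1 : GaugeConfig 4 L G), Measure.pi_pi]
  refine pos_iff_ne_zero.2 (Finset.prod_ne_zero_iff.2 fun e _ => ?_)
  exact ((isOpen_discrete _).measure_pos (haarProbability G) (singleton_nonempty _)).ne'

/-- **`WilsonPartitionRegularVariation` for finite gauge groups, outright** (`λ = 0`, `m = 0`):
`Z_L(β) → Haar^{⊗E}{S = 0} > 0` as `β → ∞`. [folklore] -/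
theorem tendsto_partitionFunction_of_finite [Finite G] (r : LatticeRep G) (L : ℕ) [NeZero L] :
    ∃ C : ℝ, 0 < C ∧
      Tendsto (fun β : ℝ =>
        (partitionFunction (d := 4) (L := L) r.ρ β).toReal * β ^ (0 : ℝ) / Real.log β ^ (0 : ℕ))
        atTop (𝓝 C) := by
  let μ := Measure.pi fun _ : Edge 4 L => haarProbability G
  set c : ℝ := (μ {U | wilsonAction r.ρ U ≤ 0}).toReal with hc
  have hcpos : 0 < c :=
    ENNReal.toReal_pos (measure_wilsonAction_le_zero_pos r L).ne' (measure_ne_top _ _)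
  obtain ⟨t₀, ht₀, heq⟩ := exists_sublevel_eq_of_finite r L
  have hV : Tendsto (fun t : ℝ => (μ {U | wilsonAction r.ρ U ≤ t}).toReal /
      (t ^ (0 : ℝ) * Real.log t⁻¹ ^ (0 : ℕ))) (𝓝[>] 0) (𝓝 c) := by
    refine (tendsto_const_nhds (x := c)).congr' ?_
    filter_upwards [Ioo_mem_nhdsGT ht₀] with t ht
    rw [Real.rpow_zero, pow_zero, mul_one, div_one, heq t ht.1.le ht.2]
  refine ⟨c * Real.Gamma (0 + 1), mul_pos hcpos (Real.Gamma_pos_of_pos (by norm_num)), ?_⟩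
  have key := LaplacePowerLog.tendsto_laplace_mul_rpow_div_log_pow (μ := μ)
    (WilsonRP.measurable_wilsonAction r.ρ r.continuous) r.wilsonAction_nonneg le_rfl hV
  refine key.congr' (Eventually.of_forall fun β => ?_)
  simp only [partitionFunction_toReal_eq_integral r.ρ r.continuous β, neg_mul]
  rfl

end FiniteGroup

end Literature.MathematicalPhysics.QuantumFieldTheory

end
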